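import Summits.NavierStokesRegularity.NavierStokesRegularity.Theses.AxisymmetricExtremality
import Summits.NavierStokesRegularity.NavierStokesRegularity.Theorems.AxisymmetricExtremalityAxisymmetricKatoGlobalStubSereginLogSwirlOriginStep3LocalEquations
import HarnessLib

/-!
# Seregin 2022, §2 Step 3 for the LOCAL smooth class (II): the equation of `Φ = ω_r/r` as an
# identity of smooth functions, and the time derivatives of `Γ`, `Φ` off the axis from the
# pointwise vorticity equation — crux stmt-NavierStokesRegularity-15453
# (`AxisymmetricExtremality.AxisymmetricKatoGlobal`), line registered, support for stub `stub_sereginLogSwirlOrigin`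

Support file (`--supports stmt-NavierStokesRegularity-15453`; theorems only, everything proved)
toward the registered stub `stub_sereginLogSwirlOrigin` = the named fact
`Literature.Analysis.FluidPDE.seregin2022_logSwirl_regularAtOrigin` (G. Seregin, J. Math. Fluid
Mech. 24 (2022), Paper 27 = arXiv:2201.00153, §2), sequel of `…Step3LocalEquations` (see its
module docstring for the setting: Step 3 for the local Seregin–Zajaczkowski class, where only
the pointwise vorticity equation `d/ds curl V(s) x = W(t, x)`, `W = Δω − Dω[V] + DV[ω]`, is
available). This file:

* `radVelQuot_vorticityRHS_eq_of_ne`, `radVelQuot_vorticityRHS_eq` (registered sub-goal) —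
  **the `Φ`-equation as an identity of smooth functions on `ℝ³`**: for an axisymmetric
  `u ∈ C^∞(ℝ³)` and `W = νΔω − Dω[u] + Du[ω]`,
  `radVelQuot W + DΦ[u] = ν(ΔΦ + 2q_Φ) + D(u_r/r)[ω]` everywhere (`Φ = radVelQuot (curl u)`,
  `u_r/r = radVelQuot u`); the algebra of `IsClassicalNSSolutionOn.radVelQuot_curl_eq_of_ne`
  with `⟪x_h, ∂ₜω⟫` replaced by `⟪x_h, W⟫`, then continuity across the axis;
* `hasDerivAt_angVortQuot_of_ne`, `hasDerivAt_radVelQuot_curl_of_ne` — **the time derivatives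
  off the axis**: for a family `v` with `C³` axisymmetric slices on an open time set, if
  `s ↦ curl (v s) x` has derivative `W x` at `t` (`W ∈ C²` axisymmetric), then
  `s ↦ Γ(s, x) = angVortQuot (v s) x` has derivative `angVelQuot W x` and
  `s ↦ Φ(s, x) = radVelQuot (curl (v s)) x` has derivative `radVelQuot W x` at `t`
  (`cylRadius x ≠ 0`: there `Γ = ⟪Jx, ω⟫/r²`, `Φ = ⟪x_h, ω⟫/r²` along the whole time line).
  Together with the slice identities this is Seregin's pair of equations in time-derivative
  form; the axis is Lebesgue-null, which is all the energy method of Step 3 needs.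

## Mathlib / tree search

Tree: the algebra of `IsClassicalNSSolutionOn.radVelQuot_curl_eq_of_ne` (`AxisymQuotientEquationsJ`:
`fderiv_horizontal_inner_apply`, `laplacian_horizontal_inner`,
`IsAxisymmetric.mul_divH_eq_fderiv_horizontal_inner`, `template_quotient_eq`,
`fderiv_apply_horizontal_eq`, `fderiv_rho_apply`, `eq_of_eq_off_ker`),
`IsAxisymmetric.cylRadius_sq_mul_radVelQuot / _angVortQuot / _angVelQuot`, `swirl_eq_inner_rotGen`,
`isAxisymmetric_vorticityRHS`, `contDiff_vorticityRHS` (`…Step3LocalEquations`). Mathlib: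
`HasDerivAt.inner`, `HasDerivAt.congr_of_eventuallyEq`, `HasDerivAt.congr_deriv`.
`lean search 'hasDerivAt_angVortQuot|hasDerivAt_radVelQuot_curl' --decl`: no matches (2026-08-17).

## References

* G. Seregin, J. Math. Fluid Mech. 24 (2022), Paper No. 27 = arXiv:2201.00153, §2 Step 3
  (arXiv p. 6, the equations of `Φ` and `Γ`). [`Seregin2022LocalAxisym`]
* Z. Lei, Q. S. Zhang, Pacific J. Math. 289 (2017) = arXiv:1505.02628, (1.4). [`LeiZhang2017`]
-/

noncomputable section

open MeasureTheory Set Function Filter Topology InnerProductSpace WithLp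
open scoped RealInnerProductSpace Laplacian ContDiff
open Literature.Analysis.FluidPDE

-- `<Problem> = <Summit>` duplicates a namespace component by design (lakefile sets the same option).
set_option linter.dupNamespace false

namespace Summit.NavierStokesRegularity.NavierStokesRegularity.Theorems.AxisymmetricKatoGlobal.EulerScaling

/-! ### The `Φ`-equation as an identity of smooth functions (fixed time) -/

section SliceEquations

variable {u : EuclideanSpace ℝ (Fin 3) → EuclideanSpace ℝ (Fin 3)}

/-- **The `Φ`-equation off the axis, slice form**: with `W = νΔω − Dω[u] + Du[ω]`,
`radVelQuot W x + DΦ(x)[u x] = ν (ΔΦ(x) + 2 q_Φ(x)) + D(u_r/r)(x)[ω x]` for `cylRadius x ≠ 0`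
(`Φ = radVelQuot (curl u)`, `u_r/r = radVelQuot u`). The algebra of
`IsClassicalNSSolutionOn.radVelQuot_curl_eq_of_ne` with `⟪x_h, ∂ₜω⟫` replaced by `⟪x_h, W⟫`.
[cite: Seregin2022LocalAxisym, §2 Step 3 (arXiv:2201.00153 p. 6, the equation of Φ)] -/
theorem radVelQuot_vorticityRHS_eq_of_ne (hu : ContDiff ℝ ∞ u) (hax : IsAxisymmetric u) (ν : ℝ)
    {x : EuclideanSpace ℝ (Fin 3)} (hx : cylRadius x ≠ 0) :
    radVelQuot (fun y => ν • (Δ (curl u)) y - fderiv ℝ (curl u) y (u y) +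
        fderiv ℝ u y (curl u y)) x + fderiv ℝ (radVelQuot (curl u)) x (u x) =
      ν * ((Δ (radVelQuot (curl u))) x + 2 * radDerivQuot (radVelQuot (curl u)) x) +
        fderiv ℝ (radVelQuot u) x (curl u x) := by
  set W : EuclideanSpace ℝ (Fin 3) → EuclideanSpace ℝ (Fin 3) := fun y =>
    ν • (Δ (curl u)) y - fderiv ℝ (curl u) y (u y) + fderiv ℝ u y (curl u y) with hWdef
  -- regularity
  have hv2 : ContDiff ℝ 2 u := hu.of_le (by norm_cast)
  have hv3 : ContDiff ℝ 3 u := hu.of_le (by norm_cast)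
  have hvd : Differentiable ℝ u := hu.differentiable (by simp)
  have hω : ContDiff ℝ ∞ (curl u) := contDiff_curl (n := ⊤) (by exact_mod_cast hu)
  have hω2 : ContDiff ℝ 2 (curl u) := hω.of_le (by norm_cast)
  have hω4 : ContDiff ℝ 4 (curl u) := hω.of_le (by norm_cast)
  have hωd : Differentiable ℝ (curl u) := hω.differentiable (by simp)
  have haxω : IsAxisymmetric (curl u) := hax.curl hvd
  have hW : ContDiff ℝ ∞ W := contDiff_vorticityRHS hu ν
  have hW2 : ContDiff ℝ 2 W := hW.of_le (by norm_cast)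
  have hWax : IsAxisymmetric W := isAxisymmetric_vorticityRHS hax (hu.of_le (by norm_cast)) ν
  have hJ : ContDiff ℝ 2 (radVelQuot (curl u)) := contDiff_radVelQuot (n := 2) hω4
  have hJax : IsAxisymmetricScalar (radVelQuot (curl u)) := haxω.isAxisymmetricScalar_radVelQuot hω2
  have hWr : ContDiff ℝ 1 (radVelQuot u) := contDiff_radVelQuot (n := 1) hv3
  have hWrd : Differentiable ℝ (radVelQuot u) := hWr.differentiable one_ne_zero
  have hρd : Differentiable ℝ (fun y : EuclideanSpace ℝ (Fin 3) => y 0 ^ 2 + y 1 ^ 2) :=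
    contDiff_horizSq.differentiable two_ne_zero
  have hρx : x 0 ^ 2 + x 1 ^ 2 ≠ 0 := by
    rwa [sq_add_sq_eq_cylRadius_sq, pow_ne_zero_iff two_ne_zero]
  -- the components of `W x`
  have hφ : x 0 * W x 0 + x 1 * W x 1 =
      x 0 * (ν * (Δ (curl u)) x 0 - fderiv ℝ (curl u) x (u x) 0 + fderiv ℝ u x (curl u x) 0) +
      x 1 * (ν * (Δ (curl u)) x 1 - fderiv ℝ (curl u) x (u x) 1 + fderiv ℝ u x (curl u x) 1) := by
    simp only [hWdef, PiLp.add_apply, PiLp.sub_apply, PiLp.smul_apply, smul_eq_mul]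
  -- (i) the "time derivative": `⟪x_h, W⟫ = ρ radVelQuot W`
  have ht1 : x 0 * W x 0 + x 1 * W x 1 = (x 0 ^ 2 + x 1 ^ 2) * radVelQuot W x := by
    rw [sq_add_sq_eq_cylRadius_sq, hWax.cylRadius_sq_mul_radVelQuot hW2 x]
  -- (ii) transport: `⟪x_h, Dω[u]⟫ = DΣ[u] − ⟪u_h, ω_h⟫`
  have htr := fderiv_horizontal_inner_apply (hωd x) (u x)
  -- (iii) stretching: `⟪x_h, Du[ω]⟫ = DP[ω] − ⟪ω_h, u_h⟫`
  have hst := fderiv_horizontal_inner_apply (hvd x) (curl u x)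
  -- (iv) viscosity: `⟪x_h, Δω⟫ = ΔΣ − (2/ρ) DΣ[x_h]`
  have hlap := laplacian_horizontal_inner hω2 x
  have hdivH := haxω.mul_divH_eq_fderiv_horizontal_inner (hωd x)
  have hvisc : x 0 * (Δ (curl u)) x 0 + x 1 * (Δ (curl u)) x 1 =
      (Δ (fun y : EuclideanSpace ℝ (Fin 3) => y 0 * curl u y 0 + y 1 * curl u y 1)) x -
        2 / (x 0 ^ 2 + x 1 ^ 2) *
          fderiv ℝ (fun y => y 0 * curl u y 0 + y 1 * curl u y 1) x
            ((x 0) • EuclideanSpace.single 0 1 + (x 1) • EuclideanSpace.single 1 1) := by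
    rw [hlap, ← hdivH]
    field_simp
    ring
  -- the equation of `Σ = ⟪x_h, ω⟫`: `ρ(radVelQuot W) + DΣ[u] = ν (ΔΣ − (2/ρ) DΣ[x_h]) + DP[ω]`
  have hpde : (x 0 ^ 2 + x 1 ^ 2) * radVelQuot W x +
      fderiv ℝ (fun y => y 0 * curl u y 0 + y 1 * curl u y 1) x (u x) =
      ν * ((Δ (fun y : EuclideanSpace ℝ (Fin 3) => y 0 * curl u y 0 + y 1 * curl u y 1)) x -
        2 / (x 0 ^ 2 + x 1 ^ 2) *
          fderiv ℝ (fun y => y 0 * curl u y 0 + y 1 * curl u y 1) x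
            ((x 0) • EuclideanSpace.single 0 1 + (x 1) • EuclideanSpace.single 1 1)) +
        fderiv ℝ (fun y => y 0 * u y 0 + y 1 * u y 1) x (curl u x) := by
    rw [← ht1, htr, ← hvisc, hst]
    linear_combination hφ
  -- `Σ = ρ J`, `P = ρ (u_r/r)` as functions
  have hSig : (fun y : EuclideanSpace ℝ (Fin 3) => y 0 * curl u y 0 + y 1 * curl u y 1) =
      fun y => (y 0 ^ 2 + y 1 ^ 2) * radVelQuot (curl u) y := by
    funext y
    rw [sq_add_sq_eq_cylRadius_sq, haxω.cylRadius_sq_mul_radVelQuot hω2 y]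
  have hP : (fun y : EuclideanSpace ℝ (Fin 3) => y 0 * u y 0 + y 1 * u y 1) =
      fun y => (y 0 ^ 2 + y 1 ^ 2) * radVelQuot u y := by
    funext y
    rw [sq_add_sq_eq_cylRadius_sq, hax.cylRadius_sq_mul_radVelQuot hv2 y]
  rw [hSig, hP] at hpde
  -- the template, with `R = DP[ω]`
  have key := template_quotient_eq hJ hρx (ν := ν)
    (R := fderiv ℝ (fun y : EuclideanSpace ℝ (Fin 3) => (y 0 ^ 2 + y 1 ^ 2) * radVelQuot u y) x
      (curl u x)) (c := u x) (σ' := radVelQuot W x) (by linarith [hpde])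
  -- `DP[ω] = ρ (2 J (u_r/r) + D(u_r/r)[ω])`
  have hR : fderiv ℝ (fun y : EuclideanSpace ℝ (Fin 3) => (y 0 ^ 2 + y 1 ^ 2) * radVelQuot u y) x
      (curl u x) = (x 0 ^ 2 + x 1 ^ 2) * (2 * radVelQuot (curl u) x * radVelQuot u x +
        fderiv ℝ (radVelQuot u) x (curl u x)) := by
    rw [fderiv_fun_mul (hρd x) (hWrd x)]
    simp only [_root_.add_apply, _root_.FunLike.coe_smul, Pi.smul_apply, smul_eq_mul,
      fderiv_rho_apply]
    have e : x 0 * curl u x 0 + x 1 * curl u x 1 = (x 0 ^ 2 + x 1 ^ 2) * radVelQuot (curl u) x := by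
      rw [sq_add_sq_eq_cylRadius_sq, haxω.cylRadius_sq_mul_radVelQuot hω2 x]
    rw [e]
    ring
  rw [fderiv_apply_horizontal_eq hJ hJax, ← sq_add_sq_eq_cylRadius_sq,
    ← hax.cylRadius_sq_mul_radVelQuot hv2 x, ← sq_add_sq_eq_cylRadius_sq, hR] at key
  have e1 : 2 * radVelQuot (curl u) x * ((x 0 ^ 2 + x 1 ^ 2) * radVelQuot u x) /
      (x 0 ^ 2 + x 1 ^ 2) = 2 * radVelQuot (curl u) x * radVelQuot u x := by
    field_simp
  have e2 : 2 / (x 0 ^ 2 + x 1 ^ 2) * ((x 0 ^ 2 + x 1 ^ 2) * radDerivQuot (radVelQuot (curl u)) x) =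
      2 * radDerivQuot (radVelQuot (curl u)) x := by
    field_simp
  have e3 : (x 0 ^ 2 + x 1 ^ 2) * (2 * radVelQuot (curl u) x * radVelQuot u x +
      fderiv ℝ (radVelQuot u) x (curl u x)) / (x 0 ^ 2 + x 1 ^ 2) =
      2 * radVelQuot (curl u) x * radVelQuot u x + fderiv ℝ (radVelQuot u) x (curl u x) := by
    field_simp
  rw [e1, e2, e3] at key
  linarith

/-- **Seregin's `Φ`-equation as an identity of smooth functions on `ℝ³`** (Step 3:
"`∂ₜΦ + (v − 2x'/|x'|²)·∇Φ − ΔΦ − ω·∇(v_r/r) = 0`", with `∂ₜΦ` rendered by `radVelQuot W`,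
`W = νΔω − Dω[u] + Du[ω]`): for an axisymmetric `u ∈ C^∞(ℝ³)`, at EVERY `x`,
`radVelQuot W x + DΦ(x)[u x] = ν (ΔΦ(x) + 2 radDerivQuot Φ x) + D(radVelQuot u)(x)[curl u x]`
(`Φ = radVelQuot (curl u)`). [cite: Seregin2022LocalAxisym, §2 Step 3 (arXiv:2201.00153 p. 6, the equation of Φ)] -/
theorem radVelQuot_vorticityRHS_eq : ∀ (u : EuclideanSpace ℝ (Fin 3) → EuclideanSpace ℝ (Fin 3)) (ν : ℝ), ContDiff ℝ (⊤ : ℕ∞) u → IsAxisymmetric u → ∀ x : EuclideanSpace ℝ (Fin 3), radVelQuot (fun y => ν • (Δ (curl u)) y - fderiv ℝ (curl u) y (u y) + fderiv ℝ u y (curl u y)) x + fderiv ℝ (radVelQuot (curl u)) x (u x) = ν * ((Δ (radVelQuot (curl u))) x + 2 * radDerivQuot (radVelQuot (curl u)) x) + fderiv ℝ (radVelQuot u) x (curl u x) := by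
  intro u ν hu hax x
  have hv3 : ContDiff ℝ 3 u := hu.of_le (by norm_cast)
  have hω : ContDiff ℝ ∞ (curl u) := contDiff_curl (n := ⊤) (by exact_mod_cast hu)
  have hω4 : ContDiff ℝ 4 (curl u) := hω.of_le (by norm_cast)
  have hW : ContDiff ℝ ∞ fun y => ν • (Δ (curl u)) y - fderiv ℝ (curl u) y (u y) +
      fderiv ℝ u y (curl u y) := contDiff_vorticityRHS hu ν
  have hW3 : ContDiff ℝ 3 fun y => ν • (Δ (curl u)) y - fderiv ℝ (curl u) y (u y) +
      fderiv ℝ u y (curl u y) := hW.of_le (by norm_cast)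
  have hJ2 : ContDiff ℝ 2 (radVelQuot (curl u)) := contDiff_radVelQuot (n := 2) hω4
  have hJ' : ContDiff ℝ 1 (radVelQuot fun y => ν • (Δ (curl u)) y - fderiv ℝ (curl u) y (u y) +
      fderiv ℝ u y (curl u y)) := contDiff_radVelQuot (n := 1) hW3
  have hWr : ContDiff ℝ 1 (radVelQuot u) := contDiff_radVelQuot (n := 1) hv3
  have hL : Continuous fun y => radVelQuot (fun y => ν • (Δ (curl u)) y -
      fderiv ℝ (curl u) y (u y) + fderiv ℝ u y (curl u y)) y +
      fderiv ℝ (radVelQuot (curl u)) y (u y) :=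
    hJ'.continuous.add ((hJ2.continuous_fderiv two_ne_zero).clm_apply hu.continuous)
  have hR : Continuous fun y => ν * ((Δ (radVelQuot (curl u))) y +
      2 * radDerivQuot (radVelQuot (curl u)) y) + fderiv ℝ (radVelQuot u) y (curl u y) := by
    refine (continuous_const.mul ((continuous_laplacian hJ2).add
      (continuous_const.mul (continuous_radDerivQuot hJ2)))).add ?_
    exact (hWr.continuous_fderiv one_ne_zero).clm_apply hω.continuous
  refine eq_of_eq_off_ker (EuclideanSpace.proj (0 : Fin 3)) ⟨EuclideanSpace.single 0 1, by simp⟩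
    hL hR (fun z hz => ?_) x
  have hz0 : z 0 ≠ 0 := by simpa using hz
  have hzr : cylRadius z ≠ 0 := fun h => hz0 ((cylRadius_eq_zero_iff z).1 h).1
  exact radVelQuot_vorticityRHS_eq_of_ne hu hax ν hzr

end SliceEquations

/-! ### The time derivatives of `Γ` and `Φ` off the axis from the pointwise vorticity equation -/

section TimeDerivative

variable {S : Set ℝ} {v : ℝ → EuclideanSpace ℝ (Fin 3) → EuclideanSpace ℝ (Fin 3)}
  {W : EuclideanSpace ℝ (Fin 3) → EuclideanSpace ℝ (Fin 3)} {t : ℝ} {x : EuclideanSpace ℝ (Fin 3)}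

/-- **`∂ₜΓ = angVelQuot (∂ₜω)` off the axis.** Let `v` have `C³` axisymmetric slices on an open
time set `S ∋ t`, let `cylRadius x ≠ 0`, and suppose the time line `s ↦ curl (v s) x` of the
vorticity at `x` has derivative `W x` at `t` for an axisymmetric `W ∈ C²` (the vorticity equation:
`W = Δω − Dω[v] + Dv[ω]`). Then `s ↦ Γ(s, x) = angVortQuot (v s) x` has derivative
`angVelQuot W x` at `t`: off the axis `Γ = ⟪Jx, ω⟫/r²` along the whole time line and
`angVelQuot W = ⟪Jx, W⟫/r²`. [folklore] -/
theorem hasDerivAt_angVortQuot_of_ne (hS : IsOpen S) (hv : ∀ s ∈ S, ContDiff ℝ 3 (v s))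
    (hax : ∀ s ∈ S, IsAxisymmetric (v s)) (ht : t ∈ S) (hx : cylRadius x ≠ 0)
    (hW : ContDiff ℝ 2 W) (hWax : IsAxisymmetric W)
    (hder : HasDerivAt (fun s => curl (v s) x) (W x) t) :
    HasDerivAt (fun s => angVortQuot (v s) x) (angVelQuot W x) t := by
  have hr2 : cylRadius x ^ 2 ≠ 0 := pow_ne_zero 2 hx
  have h1 : HasDerivAt (fun s => ⟪rotGen x, curl (v s) x⟫) (⟪rotGen x, W x⟫) t := by
    simpa using (hasDerivAt_const t (rotGen x)).inner ℝ hder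
  have h2 : HasDerivAt (fun s => (cylRadius x ^ 2)⁻¹ * ⟪rotGen x, curl (v s) x⟫)
      ((cylRadius x ^ 2)⁻¹ * ⟪rotGen x, W x⟫) t := h1.const_mul _
  have hval : (cylRadius x ^ 2)⁻¹ * ⟪rotGen x, W x⟫ = angVelQuot W x := by
    have hsw : ⟪rotGen x, W x⟫ = cylRadius x ^ 2 * angVelQuot W x := by
      rw [hWax.cylRadius_sq_mul_angVelQuot hW x]
      exact (congrFun (swirl_eq_inner_rotGen W) x).symm
    rw [hsw, ← mul_assoc, inv_mul_cancel₀ hr2, one_mul]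
  have hev : (fun s => (cylRadius x ^ 2)⁻¹ * ⟪rotGen x, curl (v s) x⟫) =ᶠ[𝓝 t]
      fun s => angVortQuot (v s) x := by
    filter_upwards [hS.mem_nhds ht] with s hs
    have h := (hax s hs).cylRadius_sq_mul_angVortQuot (hv s hs) x
    rw [congrFun (swirl_eq_inner_rotGen (curl (v s))) x] at h
    rw [← h, ← mul_assoc, inv_mul_cancel₀ hr2, one_mul]
  exact (h2.congr_of_eventuallyEq hev.symm).congr_deriv hval

/-- **`∂ₜΦ = radVelQuot (∂ₜω)` off the axis.** Same setting as `hasDerivAt_angVortQuot_of_ne`: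
`s ↦ Φ(s, x) = radVelQuot (curl (v s)) x` has derivative `radVelQuot W x` at `t` (off the axis
`Φ = ⟪x_h, ω⟫/r²`, `radVelQuot W = ⟪x_h, W⟫/r²`). [folklore] -/
theorem hasDerivAt_radVelQuot_curl_of_ne (hS : IsOpen S) (hv : ∀ s ∈ S, ContDiff ℝ 3 (v s))
    (hax : ∀ s ∈ S, IsAxisymmetric (v s)) (ht : t ∈ S) (hx : cylRadius x ≠ 0)
    (hW : ContDiff ℝ 2 W) (hWax : IsAxisymmetric W)
    (hder : HasDerivAt (fun s => curl (v s) x) (W x) t) :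
    HasDerivAt (fun s => radVelQuot (curl (v s)) x) (radVelQuot W x) t := by
  have hr2 : cylRadius x ^ 2 ≠ 0 := pow_ne_zero 2 hx
  have h1 : HasDerivAt (fun s => ⟪(toLp 2 ![x 0, x 1, 0] : EuclideanSpace ℝ (Fin 3)), curl (v s) x⟫)
      (⟪(toLp 2 ![x 0, x 1, 0] : EuclideanSpace ℝ (Fin 3)), W x⟫) t := by
    simpa using (hasDerivAt_const t (toLp 2 ![x 0, x 1, 0] : EuclideanSpace ℝ (Fin 3))).inner ℝ hder
  have h2 : HasDerivAt (fun s => (cylRadius x ^ 2)⁻¹ *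
      ⟪(toLp 2 ![x 0, x 1, 0] : EuclideanSpace ℝ (Fin 3)), curl (v s) x⟫)
      ((cylRadius x ^ 2)⁻¹ * ⟪(toLp 2 ![x 0, x 1, 0] : EuclideanSpace ℝ (Fin 3)), W x⟫) t :=
    h1.const_mul _
  have hval : (cylRadius x ^ 2)⁻¹ * ⟪(toLp 2 ![x 0, x 1, 0] : EuclideanSpace ℝ (Fin 3)), W x⟫ =
      radVelQuot W x := by
    rw [SereginZajaczkowski2007.inner_horizontal_left, ← hWax.cylRadius_sq_mul_radVelQuot hW x, ← mul_assoc,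
      inv_mul_cancel₀ hr2, one_mul]
  have hev : (fun s => (cylRadius x ^ 2)⁻¹ *
      ⟪(toLp 2 ![x 0, x 1, 0] : EuclideanSpace ℝ (Fin 3)), curl (v s) x⟫) =ᶠ[𝓝 t]
      fun s => radVelQuot (curl (v s)) x := by
    filter_upwards [hS.mem_nhds ht] with s hs
    have hω2 : ContDiff ℝ 2 (curl (v s)) := contDiff_curl (n := 2) (by exact_mod_cast hv s hs)
    have haxω : IsAxisymmetric (curl (v s)) :=
      (hax s hs).curl ((hv s hs).differentiable (by norm_cast))
    rw [SereginZajaczkowski2007.inner_horizontal_left, ← haxω.cylRadius_sq_mul_radVelQuot hω2 x, ← mul_assoc,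
      inv_mul_cancel₀ hr2, one_mul]
  exact (h2.congr_of_eventuallyEq hev.symm).congr_deriv hval

end TimeDerivative

end Summit.NavierStokesRegularity.NavierStokesRegularity.Theorems.AxisymmetricKatoGlobal.EulerScaling

end
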